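import Mathlib.Algebra.Order.Field.GeomSum
import Literature.Probability.RandomPlanarGeometry.BackwardSLEMartingale
import HarnessLib

/-!
# Rohde–Schramm's Corollary 3.5 for the backward SLE flow on the canonical space

Trunk T-STOCH. We prove the one-point derivative estimate of Rohde–Schramm, *Basic properties of
SLE*, Ann. Math. 161 (2005), **Cor. 3.5** (p. 894), for the backward SLE_κ flow `hₜ(w)` driven by
the canonical Brownian motion (`BackwardSLEFlow`): for `κ > 0`, `b ∈ [0, 1 + 4/κ]`, `a, λ` as in
(3.6) (`RohdeSchramm.expA`, `RohdeSchramm.expLam`), there is `C(κ, b)` such that for all `t ≤ 1`,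
`y, δ ∈ (0, 1]`, `x ∈ ℝ`,

  `P[ |hₜ'(x + iy)| ≥ δ/y ] ≤ C(κ, b) (1 + x²/y²)^b (y/δ)^λ ϑ(δ, a - λ)`

(`measure_le_norm_deriv_bwdFlow_le`). By Lemma 3.1 (`BackwardLoewnerReversal`) `hₜ'` has the law
of `f̂ₜ'`, so this is Cor. 3.5 on the canonical space; the transfer to an arbitrary Brownian motion
is done elsewhere.

The proof is the printed one (p. 894) with Thm. 3.2 entering through the supermartingale/hitting
estimate `measure_bwdSLEImHit_le_and_le_norm_deriv_le` (`BackwardSLEMartingale`): with the levels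
`L_k = y eᵏ`, `k = 0, …, K = ⌈log(3/y)⌉` and their hitting times `T_k` by `Y = im h`,
* pathwise, if `|hₜ'| ≥ δ/y` then for the last level `k` hit before `t` one has `Yₜ ≤ e L_k`
  (the next level is not hit, or `Yₜ ≤ √5 < 3 ≤ L_K`), hence `|h'_{T_k}| ≥ |hₜ'|/e ≥ δ/(ey)`
  ("`|g'₋ₜ(z)/g'_{T_u}(z)| ≤ exp |u - u₁|`", (3.17)) and `y e^{k+1} ≥ δ` ("the Schwarz lemma",
  `|h'_{T_k}| ≤ Y_{T_k}/y = eᵏ`), i.e. the event is covered by finitely many hitting events;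
* Chebyshev at each `T_k` (Thm. 3.2): `P[T_k ≤ t, |h'_{T_k}| ≥ δ/(ey)] ≤ (1 + x²/y²)^b eᵃ (y/δ)^λ (y eᵏ/δ)^{a-λ}`;
* the geometric sums over the admissible `k` (`RohdeSchramm.sum_levelSet_rpow_le`) give the factor
  `ϑ(δ, a - λ)` ((3.18) and the last display of the proof).

## References

* S. Rohde, O. Schramm, *Basic properties of SLE*, Ann. of Math. 161 (2005), Cor. 3.5 and its
  proof (p. 894), Thm. 3.2, Lemma 3.1, (3.17)–(3.18).
-/

noncomputable section

open Set Filter MeasureTheory Complex Finset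
open _root_.Topology
open scoped NNReal ENNReal

namespace Literature.Probability.RandomPlanarGeometry

open Loewner Literature.Probability.Process RohdeSchramm

/-! ### The level sums -/

namespace RohdeSchramm

/-- The number of levels: `K = ⌈log(3/y)⌉`. [cite: RohdeSchramm2005, Cor 3.5 (proof)] -/
def levelCount (y : ℝ) : ℕ := ⌈Real.log (3 / y)⌉₊

/-- The admissible levels: `k ≤ K` with `y e^{k+1} ≥ δ` (the range `j ∈ [log δ, 0]` of (3.18), in
the scale `L_k = y eᵏ`). [cite: RohdeSchramm2005, Cor 3.5 (proof, (3.18))] -/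
def levelSet (y δ : ℝ) : Finset ℕ :=
  (Finset.range (levelCount y + 1)).filter fun k ↦ δ ≤ y * Real.exp ((k : ℝ) + 1)

/-- The constant of the level sum, according to the sign of `s = a - λ` (the three cases of `ϑ`).
[cite: RohdeSchramm2005, Cor 3.5] -/
def levelSumConst (s : ℝ) : ℝ :=
  if 0 < s then (3 * Real.exp 2) ^ s / (Real.exp s - 1)
  else if s = 0 then Real.log 3 + 3 else Real.exp (-s) / (1 - Real.exp s)

/-- The level-sum constant is positive. [folklore] -/
theorem levelSumConst_pos (s : ℝ) : 0 < levelSumConst s := by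
  unfold levelSumConst
  split_ifs with h1 h2
  · exact div_pos (Real.rpow_pos_of_pos (by positivity) _) (by rw [sub_pos]; exact Real.one_lt_exp_iff.2 h1)
  · have := Real.log_nonneg (by norm_num : (1 : ℝ) ≤ 3); linarith
  · have hs : s < 0 := lt_of_le_of_ne (not_lt.1 h1) h2
    exact div_pos (Real.exp_pos _) (by rw [sub_pos]; exact Real.exp_lt_one_iff.2 hs)

variable {y δ : ℝ}

/-- `log(3/y) ≥ log 3 > 0` for `0 < y ≤ 1`. [folklore] -/
theorem log_three_div_pos (hy0 : 0 < y) (hy1 : y ≤ 1) : 0 < Real.log (3 / y) :=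
  Real.log_pos ((one_lt_div hy0).2 (by linarith))

/-- `K < log(3/y) + 1`. [folklore] -/
theorem levelCount_lt (hy0 : 0 < y) (hy1 : y ≤ 1) : (levelCount y : ℝ) < Real.log (3 / y) + 1 :=
  Nat.ceil_lt_add_one (log_three_div_pos hy0 hy1).le

/-- `log(3/y) ≤ K`, i.e. `3 ≤ y e^K`. [folklore] -/
theorem three_le_mul_exp_levelCount (hy0 : 0 < y) : 3 ≤ y * Real.exp (levelCount y) := by
  have h1 : Real.log (3 / y) ≤ levelCount y := Nat.le_ceil _
  have h2 : 3 / y ≤ Real.exp (levelCount y) := by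
    rw [← Real.exp_log (by positivity : 0 < 3 / y)]
    exact Real.exp_le_exp.2 h1
  rw [div_le_iff₀ hy0] at h2
  linarith [mul_comm y (Real.exp (levelCount y))]

/-- `y e^{K+1} ≤ 3e²`. [folklore] -/
theorem mul_exp_levelCount_succ_le (hy0 : 0 < y) (hy1 : y ≤ 1) :
    y * Real.exp ((levelCount y : ℝ) + 1) ≤ 3 * Real.exp 2 := by
  have h1 := levelCount_lt hy0 hy1
  have h2 : Real.exp ((levelCount y : ℝ) + 1) ≤ Real.exp (Real.log (3 / y) + 2) :=
    Real.exp_le_exp.2 (by linarith)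
  have h3 : Real.exp (Real.log (3 / y) + 2) = 3 / y * Real.exp 2 := by
    rw [Real.exp_add, Real.exp_log (by positivity)]
  rw [h3] at h2
  calc y * Real.exp ((levelCount y : ℝ) + 1) ≤ y * (3 / y * Real.exp 2) :=
        mul_le_mul_of_nonneg_left h2 hy0.le
    _ = 3 * Real.exp 2 := by field_simp

/-- The terms of the level sum factor: `(y eᵏ/δ)^s = (y/δ)^s (eˢ)ᵏ`. [folklore] -/
theorem levelTerm_eq (hy0 : 0 < y) (hδ0 : 0 < δ) (s : ℝ) (k : ℕ) :
    (y * Real.exp k / δ) ^ s = (y / δ) ^ s * Real.exp s ^ k := by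
  rw [mul_div_right_comm, Real.mul_rpow (by positivity) (Real.exp_pos _).le, ← Real.exp_mul,
    Real.exp_nat_mul]

/-- Membership in the admissible set, unfolded. [folklore] -/
theorem mem_levelSet {k : ℕ} : k ∈ levelSet y δ ↔ k < levelCount y + 1 ∧ δ ≤ y * Real.exp ((k : ℝ) + 1) := by
  simp [levelSet]

/-- **The level sum, `s > 0`**: `∑ (y eᵏ/δ)^s ≤ (3e²)^s δ^{-s}/(eˢ - 1)`. [cite: RohdeSchramm2005, Cor 3.5 (proof)] -/
theorem sum_levelSet_rpow_le_of_pos (hy0 : 0 < y) (hy1 : y ≤ 1) (hδ0 : 0 < δ) {s : ℝ} (hs : 0 < s) :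
    ∑ k ∈ levelSet y δ, (y * Real.exp k / δ) ^ s ≤ (3 * Real.exp 2) ^ s / (Real.exp s - 1) * δ ^ (-s) := by
  have hq1 : 1 < Real.exp s := Real.one_lt_exp_iff.2 hs
  have hq0 : 0 < Real.exp s - 1 := by linarith
  set K := levelCount y with hK
  have hsub : levelSet y δ ⊆ Finset.range (K + 1) := Finset.filter_subset _ _
  calc ∑ k ∈ levelSet y δ, (y * Real.exp k / δ) ^ s
      ≤ ∑ k ∈ Finset.range (K + 1), (y * Real.exp k / δ) ^ s :=
        Finset.sum_le_sum_of_subset_of_nonneg hsub fun k _ _ ↦ Real.rpow_nonneg (by positivity) _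
    _ = (y / δ) ^ s * ∑ k ∈ Finset.range (K + 1), Real.exp s ^ k := by
        rw [Finset.mul_sum]
        exact Finset.sum_congr rfl fun k _ ↦ levelTerm_eq hy0 hδ0 s k
    _ = (y / δ) ^ s * ((Real.exp s ^ (K + 1) - 1) / (Real.exp s - 1)) := by rw [geom_sum_eq hq1.ne']
    _ ≤ (y / δ) ^ s * (Real.exp s ^ (K + 1) / (Real.exp s - 1)) :=
        mul_le_mul_of_nonneg_left (div_le_div_of_nonneg_right (by linarith) hq0.le)
          (Real.rpow_nonneg (by positivity) _)
    _ = (y * Real.exp ((K : ℝ) + 1) / δ) ^ s / (Real.exp s - 1) := by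
        rw [mul_div_assoc', mul_div_right_comm y, Real.mul_rpow (by positivity) (Real.exp_pos _).le,
          ← Real.exp_mul, show ((K : ℝ) + 1) * s = ((K + 1 : ℕ) : ℝ) * s by push_cast; ring,
          Real.exp_nat_mul]
    _ ≤ (3 * Real.exp 2 / δ) ^ s / (Real.exp s - 1) := by
        refine div_le_div_of_nonneg_right ?_ hq0.le
        exact Real.rpow_le_rpow (by positivity)
          (div_le_div_of_nonneg_right (mul_exp_levelCount_succ_le hy0 hy1) hδ0.le) hs.le
    _ = (3 * Real.exp 2) ^ s / (Real.exp s - 1) * δ ^ (-s) := by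
        rw [Real.div_rpow (by positivity) hδ0.le, Real.rpow_neg hδ0.le]
        ring

/-- The least admissible level `k₀` satisfies `y e^{k₀} ≥ δ/e` and every admissible `k` is `≥ k₀`,
`< K + 1`. [folklore] -/
theorem levelSet_subset_Ico (hne : (levelSet y δ).Nonempty) :
    levelSet y δ ⊆ Finset.Ico ((levelSet y δ).min' hne) (levelCount y + 1) := fun _ hk ↦
  Finset.mem_Ico.2 ⟨Finset.min'_le _ _ hk, (mem_levelSet.1 hk).1⟩

/-- **The level sum, `s < 0`**: `∑ (y eᵏ/δ)^s ≤ e^{-s}/(1 - eˢ)`. [cite: RohdeSchramm2005, Cor 3.5 (proof)] -/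
theorem sum_levelSet_rpow_le_of_neg (hy0 : 0 < y) (hδ0 : 0 < δ) {s : ℝ} (hs : s < 0) :
    ∑ k ∈ levelSet y δ, (y * Real.exp k / δ) ^ s ≤ Real.exp (-s) / (1 - Real.exp s) := by
  have hq1 : Real.exp s < 1 := Real.exp_lt_one_iff.2 hs
  have hq0 : 0 < 1 - Real.exp s := by linarith
  rcases (levelSet y δ).eq_empty_or_nonempty with he | hne
  · rw [he, Finset.sum_empty]; positivity
  set k₀ := (levelSet y δ).min' hne with hk₀
  have hk₀mem : k₀ ∈ levelSet y δ := Finset.min'_mem _ hne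
  have hadm : δ ≤ y * Real.exp ((k₀ : ℝ) + 1) := (mem_levelSet.1 hk₀mem).2
  -- `(y e^{k₀}/δ)^s ≤ e^{-s}` since `y e^{k₀}/δ ≥ e⁻¹` and `s < 0`
  have hbase : Real.exp (-1) ≤ y * Real.exp k₀ / δ := by
    rw [le_div_iff₀ hδ0, Real.exp_neg, inv_mul_le_iff₀ (Real.exp_pos 1)]
    calc δ ≤ y * Real.exp ((k₀ : ℝ) + 1) := hadm
      _ = Real.exp 1 * (y * Real.exp k₀) := by rw [Real.exp_add]; ring
  have hpow : (y * Real.exp k₀ / δ) ^ s ≤ Real.exp (-s) := by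
    have := Real.rpow_le_rpow_of_nonpos (Real.exp_pos (-1)) hbase hs.le
    rwa [← Real.exp_mul, show (-1 : ℝ) * s = -s by ring] at this
  calc ∑ k ∈ levelSet y δ, (y * Real.exp k / δ) ^ s
      ≤ ∑ k ∈ Finset.Ico k₀ (levelCount y + 1), (y * Real.exp k / δ) ^ s :=
        Finset.sum_le_sum_of_subset_of_nonneg (levelSet_subset_Ico hne)
          fun k _ _ ↦ Real.rpow_nonneg (by positivity) _
    _ = (y / δ) ^ s * ∑ k ∈ Finset.Ico k₀ (levelCount y + 1), Real.exp s ^ k := by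
        rw [Finset.mul_sum]
        exact Finset.sum_congr rfl fun k _ ↦ levelTerm_eq hy0 hδ0 s k
    _ ≤ (y / δ) ^ s * (Real.exp s ^ k₀ / (1 - Real.exp s)) :=
        mul_le_mul_of_nonneg_left (geom_sum_Ico_le_of_lt_one (Real.exp_pos _).le hq1)
          (Real.rpow_nonneg (by positivity) _)
    _ = (y * Real.exp k₀ / δ) ^ s / (1 - Real.exp s) := by
        rw [levelTerm_eq hy0 hδ0 s k₀]; ring
    _ ≤ Real.exp (-s) / (1 - Real.exp s) := by gcongr

/-- **The level sum, `s = 0`**: the number of admissible levels is `≤ log 3 + 3 + |log δ|`.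
[cite: RohdeSchramm2005, Cor 3.5 (proof)] -/
theorem card_levelSet_le (hy0 : 0 < y) (hy1 : y ≤ 1) (hδ0 : 0 < δ) (hδ1 : δ ≤ 1) :
    ((levelSet y δ).card : ℝ) ≤ (Real.log 3 + 3) * (1 + |Real.log δ|) := by
  have hl3 : 0 ≤ Real.log 3 := Real.log_nonneg (by norm_num)
  have hlogδ : Real.log δ ≤ 0 := Real.log_nonpos hδ0.le hδ1
  have habs : |Real.log δ| = -Real.log δ := abs_of_nonpos hlogδ
  rcases (levelSet y δ).eq_empty_or_nonempty with he | hne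
  · rw [he, Finset.card_empty, Nat.cast_zero]; positivity
  set k₀ := (levelSet y δ).min' hne with hk₀
  have hk₀mem : k₀ ∈ levelSet y δ := Finset.min'_mem _ hne
  have hadm : δ ≤ y * Real.exp ((k₀ : ℝ) + 1) := (mem_levelSet.1 hk₀mem).2
  -- `log δ ≤ log y + k₀ + 1`
  have hk₀ge : Real.log δ ≤ Real.log y + (k₀ + 1) := by
    have := Real.log_le_log hδ0 hadm
    rwa [Real.log_mul hy0.ne' (Real.exp_pos _).ne', Real.log_exp] at this
  have hK := levelCount_lt hy0 hy1
  rw [Real.log_div (by norm_num) hy0.ne'] at hK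
  have hcard : ((levelSet y δ).card : ℝ) ≤ (levelCount y + 1 : ℕ) - k₀ := by
    have h1 := Finset.card_le_card (levelSet_subset_Ico hne)
    rw [Nat.card_Ico] at h1
    have h2 : k₀ ≤ levelCount y + 1 := (mem_levelSet.1 hk₀mem).1.le
    have : (((levelCount y + 1 - k₀ : ℕ) : ℝ)) = ((levelCount y + 1 : ℕ) : ℝ) - k₀ := by
      rw [Nat.cast_sub h2]
    rw [← this]
    exact_mod_cast h1
  calc ((levelSet y δ).card : ℝ) ≤ (levelCount y + 1 : ℕ) - k₀ := hcard
    _ ≤ Real.log 3 + 3 + |Real.log δ| := by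
        push_cast
        rw [habs]
        linarith
    _ ≤ (Real.log 3 + 3) * (1 + |Real.log δ|) := by
        nlinarith [abs_nonneg (Real.log δ)]

/-- **The level sum bounded by `ϑ`**: for `0 < y ≤ 1`, `0 < δ ≤ 1` and every real `s`,
`∑_{k admissible} (y eᵏ/δ)^s ≤ C(s) ϑ(δ, s)` (the three cases `s > 0`, `s = 0`, `s < 0` of
Rohde–Schramm's `ϑ`; last display of the proof of Cor. 3.5). [cite: RohdeSchramm2005, Cor 3.5 (proof)] -/
theorem sum_levelSet_rpow_le (hy0 : 0 < y) (hy1 : y ≤ 1) (hδ0 : 0 < δ) (hδ1 : δ ≤ 1) (s : ℝ) :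
    ∑ k ∈ levelSet y δ, (y * Real.exp k / δ) ^ s ≤ levelSumConst s * theta δ s := by
  rcases lt_trichotomy 0 s with hs | rfl | hs
  · rw [levelSumConst, if_pos hs, theta_of_pos δ hs]
    exact sum_levelSet_rpow_le_of_pos hy0 hy1 hδ0 hs
  · rw [levelSumConst, if_neg (lt_irrefl 0), if_pos rfl, theta_zero]
    simp only [Real.rpow_zero, Finset.sum_const, nsmul_eq_mul, mul_one]
    exact card_levelSet_le hy0 hy1 hδ0 hδ1
  · rw [levelSumConst, if_neg (not_lt.2 hs.le), if_neg hs.ne, theta_of_neg δ hs, mul_one]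
    exact sum_levelSet_rpow_le_of_neg hy0 hδ0 hs

/-- **`a ≥ 0` on the admissible range of Cor. 3.5**: `a = 2b + κb(1-b)/2 = (b/2)(4 + κ(1-b)) ≥ 0`
for `0 ≤ b ≤ 1 + 4/κ`, `κ > 0` ("Note that `a ≥ 0`", p. 894). [cite: RohdeSchramm2005, Cor 3.5 (proof)] -/
theorem expA_nonneg {κ b : ℝ} (hκ : 0 < κ) (hb0 : 0 ≤ b) (hb1 : b ≤ 1 + 4 / κ) : 0 ≤ expA κ b := by
  rw [expA]
  have h1 : κ * (1 - b) ≥ -4 := by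
    have : b - 1 ≤ 4 / κ := by linarith
    have := (le_div_iff₀ hκ).1 this
    nlinarith
  nlinarith

/-- The constant of Cor. 3.5 (canonical backward flow): `C(κ, b) = eᵃ · C_level(a - λ)`.
[cite: RohdeSchramm2005, Cor 3.5] -/
def cor35Const (κ b : ℝ) : ℝ := Real.exp (expA κ b) * levelSumConst (expA κ b - expLam κ b)

/-- `C(κ, b) > 0`. [folklore] -/
theorem cor35Const_pos (κ b : ℝ) : 0 < cor35Const κ b := mul_pos (Real.exp_pos _) (levelSumConst_pos _)

end RohdeSchramm

/-! ### Cor. 3.5 for the canonical backward flow -/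

section Canonical

variable {κ : ℝ≥0}

/-- `Yₜ < 3` for `t ≤ 1`, `im w ≤ 1` (`Yₜ² ≤ (im w)² + 4t ≤ 5`). [folklore] -/
theorem bwdSLEIm_lt_three {w : ℂ} (hw0 : 0 < w.im) (hw1 : w.im ≤ 1) {t : ℝ≥0} (ht : (t : ℝ) ≤ 1)
    (ω : ℝ≥0 → ℝ) : bwdSLEIm κ w t ω < 3 := by
  have h1 := sq_im_bwdFlow_le (continuous_sleDriving κ ω) hw0 t
  have hpos := bwdSLEIm_pos hw0 t ω (κ := κ)
  rw [bwdSLEIm_apply] at hpos ⊢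
  nlinarith

/-- **The covering step of the proof of Cor. 3.5** (pathwise). If `|hₜ'(w)| ≥ δ/im w` (`t ≤ 1`,
`im w ≤ 1`), then for some admissible level `k` (`k ≤ K`, `im w · e^{k+1} ≥ δ`) the hitting time `T_k`
of `L_k = im w · eᵏ` by `Y` satisfies `T_k ≤ t` and `|h'_{T_k}(w)| ≥ δ/(e · im w)`: take the last level
hit before `t`; then `Yₜ ≤ e L_k`, so `|hₜ'| ≤ (Yₜ/Y_{T_k}) |h'_{T_k}| ≤ e |h'_{T_k}|` ((3.17)), and
`|h'_{T_k}| ≤ Y_{T_k}/im w = eᵏ` (Schwarz) forces `im w · e^{k+1} ≥ δ`.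
[cite: RohdeSchramm2005, Cor 3.5 (proof, (3.17)–(3.18))] -/
theorem exists_mem_levelSet_of_le_norm_deriv {w : ℂ} (hw0 : 0 < w.im) (hw1 : w.im ≤ 1)
    {t : ℝ≥0} (ht : (t : ℝ) ≤ 1) {δ : ℝ} {ω : ℝ≥0 → ℝ}
    (hev : δ / w.im ≤ ‖deriv (fun w' ↦ bwdFlow (sleDriving κ ω) w' t) w‖) :
    ∃ k ∈ levelSet w.im δ, bwdSLEImHit κ w (w.im * Real.exp k) ω ≤ t ∧
      ∃ T : ℝ≥0, bwdSLEImHit κ w (w.im * Real.exp k) ω = T ∧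
        δ / (Real.exp 1 * w.im) ≤ ‖deriv (fun w' ↦ bwdFlow (sleDriving κ ω) w' T) w‖ := by
  classical
  have hU := continuous_sleDriving κ ω
  set y := w.im with hy
  set L : ℕ → ℝ := fun k ↦ y * Real.exp k with hLdef
  have hLge : ∀ k, y ≤ L k := fun k ↦ by
    have : (1 : ℝ) ≤ Real.exp k := Real.one_le_exp (Nat.cast_nonneg k)
    simp only [hLdef]; nlinarith
  have hLsucc : ∀ k : ℕ, L (k + 1) = Real.exp 1 * L k := fun k ↦ by
    simp only [hLdef, Nat.cast_add, Nat.cast_one, Real.exp_add]; ring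
  set P : ℕ → Prop := fun k ↦ bwdSLEImHit κ w (L k) ω ≤ t with hPdef
  -- level `0` is hit at time `0`
  have hP0 : P 0 := by
    have hmem : bwdSLEIm κ w 0 ω ∈ Set.Ici (L 0) := by
      rw [Set.mem_Ici, bwdSLEIm_zero hw0]
      simp [hLdef, hy]
    have h0 : bwdSLEImHit κ w (L 0) ω ≤ ((0 : ℝ≥0) : WithTop ℝ≥0) := hittingAfter_le_of_mem le_rfl hmem
    exact h0.trans (by exact_mod_cast bot_le)
  set K := levelCount y with hK
  set k := Nat.findGreatest P K with hk
  have hPk : P k := Nat.findGreatest_spec (Nat.zero_le K) hP0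
  have hkK : k ≤ K := Nat.findGreatest_le K
  -- the hitting time `T` of level `k`
  have hne : bwdSLEImHit κ w (L k) ω ≠ ⊤ := ne_top_of_le_ne_top WithTop.coe_ne_top hPk
  obtain ⟨T, hT⟩ := WithTop.ne_top_iff_exists.1 hne
  have hT' : bwdSLEImHit κ w (L k) ω = T := hT.symm
  have hTt : T ≤ t := by
    have h1 : bwdSLEImHit κ w (L k) ω ≤ (t : WithTop ℝ≥0) := hPk
    rw [hT'] at h1
    exact_mod_cast h1
  have hYT : bwdSLEIm κ w T ω = L k := bwdSLEIm_eq_of_bwdSLEImHit_eq hw0 (hLge k) hT'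
  -- `Yₜ ≤ e L_k`
  have hYt : bwdSLEIm κ w t ω ≤ Real.exp 1 * L k := by
    rcases hkK.lt_or_eq with hlt | heq
    · have hnot : ¬ P (k + 1) := Nat.findGreatest_is_greatest (Nat.lt_succ_self k) hlt
      have hnot' : ¬ bwdSLEImHit κ w (L (k + 1)) ω ≤ (t : WithTop ℝ≥0) := hnot
      rw [not_le] at hnot'
      have := notMem_of_coe_lt_hittingAfter_zero (u := bwdSLEIm κ w) (s := Set.Ici (L (k + 1))) hnot'
      rw [Set.mem_Ici, not_le, hLsucc] at this
      exact this.le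
    · have h3 : (3 : ℝ) ≤ L k := by
        rw [heq]; exact three_le_mul_exp_levelCount hw0
      have he : (1 : ℝ) ≤ Real.exp 1 := Real.one_le_exp zero_le_one
      have hlt3 := bwdSLEIm_lt_three hw0 hw1 ht ω (κ := κ)
      nlinarith
  -- derivative comparison between `T` and `t`
  set Dt := ‖deriv (fun w' ↦ bwdFlow (sleDriving κ ω) w' t) w‖ with hDt
  set DT := ‖deriv (fun w' ↦ bwdFlow (sleDriving κ ω) w' T) w‖ with hDT
  have hLk : 0 < L k := hw0.trans_le (hLge k)
  have hcomp : Dt ≤ Real.exp 1 * DT := by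
    have h1 := norm_deriv_bwdFlow_start_le_mul hU hw0 hTt
    rw [← bwdSLEIm_apply, ← bwdSLEIm_apply, hYT] at h1
    calc Dt ≤ bwdSLEIm κ w t ω / L k * DT := h1
      _ ≤ Real.exp 1 * L k / L k * DT := by gcongr
      _ = Real.exp 1 * DT := by rw [mul_div_assoc, div_self hLk.ne', mul_one]
  have hDT : δ / (Real.exp 1 * y) ≤ DT := by
    rw [div_le_iff₀ (by positivity)]
    have := (div_le_iff₀ hw0).1 (hev.trans hcomp)
    nlinarith
  -- admissibility of `k`: `|h'_T| ≤ Y_T/y = eᵏ`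
  have hSchwarz : DT ≤ Real.exp k := by
    have h1 := norm_deriv_bwdFlow_start_le hU T hw0
    have h2 : L k / w.im = Real.exp k := by
      simp only [hLdef, hy]
      rw [mul_div_right_comm, div_self (ne_of_gt hw0), one_mul]
    rw [← bwdSLEIm_apply, hYT, h2] at h1
    exact h1
  have hadm : δ ≤ y * Real.exp ((k : ℝ) + 1) := by
    have h1 := hDT.trans hSchwarz
    rw [div_le_iff₀ (by positivity)] at h1
    calc δ ≤ Real.exp k * (Real.exp 1 * y) := h1
      _ = y * Real.exp ((k : ℝ) + 1) := by rw [Real.exp_add]; ring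
  refine ⟨k, mem_levelSet.2 ⟨Nat.lt_succ_of_le hkK, hadm⟩, hPk, T, hT', hDT⟩

/-- The rearrangement of the Chebyshev bound at level `k`: with `r = y eᵏ/δ`,
`(L/(yD))ᵃ (y/L)^λ = eᵃ (y/δ)^λ r^{a-λ}` for `L = y eᵏ`, `D = δ/(ey)`. [folklore] -/
theorem level_bound_eq {y δ a lam : ℝ} (hy : 0 < y) (hδ : 0 < δ) (k : ℕ) :
    (y * Real.exp k / (y * (δ / (Real.exp 1 * y)))) ^ a * (y / (y * Real.exp k)) ^ lam =
      Real.exp a * (y / δ) ^ lam * (y * Real.exp k / δ) ^ (a - lam) := by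
  set r := y * Real.exp k / δ with hr
  have hrpos : 0 < r := by positivity
  have h1 : y * Real.exp k / (y * (δ / (Real.exp 1 * y))) = Real.exp 1 * r := by
    rw [hr]; field_simp
  have h2 : y / (y * Real.exp k) = (y / δ) / r := by
    rw [hr]; field_simp
  rw [h1, h2, Real.mul_rpow (Real.exp_pos 1).le hrpos.le, ← Real.exp_one_rpow a,
    Real.div_rpow (by positivity) hrpos.le, Real.rpow_sub hrpos]
  field_simp

/-- **Rohde–Schramm (2005), Cor. 3.5, for the backward SLE flow on the canonical space.** Let
`κ > 0`, `b ∈ [0, 1 + 4/κ]`, `a = expA κ b`, `λ = expLam κ b`. For all `t ≤ 1`, `w = x + iy` with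
`0 < y ≤ 1`, and `δ ∈ (0, 1]`:
`P[ |hₜ'(w)| ≥ δ/y ] ≤ C(κ, b) (1 + x²/y²)^b (y/δ)^λ ϑ(δ, a - λ)` with `C(κ, b) = cor35Const κ b`.
Proof as printed (p. 894): covering by the hitting events of the levels `y eᵏ`
(`exists_mem_levelSet_of_le_norm_deriv`), Chebyshev at each hitting time from the supermartingale
form of Thm. 3.2 (`measure_bwdSLEImHit_le_and_le_norm_deriv_le`), and the geometric level sums
(`RohdeSchramm.sum_levelSet_rpow_le`). [cite: RohdeSchramm2005, Cor 3.5] -/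
theorem measure_le_norm_deriv_bwdFlow_le (hκ : κ ≠ 0) {b : ℝ} (hb0 : 0 ≤ b) (hb1 : b ≤ 1 + 4 / (κ : ℝ))
    {w : ℂ} (hw0 : 0 < w.im) (hw1 : w.im ≤ 1) {t : ℝ≥0} (ht : (t : ℝ) ≤ 1) {δ : ℝ} (hδ0 : 0 < δ)
    (hδ1 : δ ≤ 1) :
    preWienerMeasure {ω | δ / w.im ≤ ‖deriv (fun w' ↦ bwdFlow (sleDriving κ ω) w' t) w‖} ≤
      ENNReal.ofReal (cor35Const κ b * (1 + w.re ^ 2 / w.im ^ 2) ^ b * (w.im / δ) ^ expLam κ b *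
        theta δ (expA κ b - expLam κ b)) := by
  have hκpos : (0 : ℝ) < κ := by exact_mod_cast pos_iff_ne_zero.2 hκ
  set y := w.im with hy
  set a := expA κ b with hadef
  set lam := expLam κ b with hlamdef
  have ha : 0 ≤ a := expA_nonneg hκpos hb0 hb1
  set D : ℝ := δ / (Real.exp 1 * y) with hDdef
  have hD : 0 < D := by positivity
  set L : ℕ → ℝ := fun k ↦ y * Real.exp k with hLdef
  have hLge : ∀ k, y ≤ L k := fun k ↦ by
    have : (1 : ℝ) ≤ Real.exp k := Real.one_le_exp (Nat.cast_nonneg k)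
    simp only [hLdef]; nlinarith
  set E : ℕ → Set (ℝ≥0 → ℝ) := fun k ↦ {ω | bwdSLEImHit κ w (L k) ω ≤ t ∧
    ∃ T : ℝ≥0, bwdSLEImHit κ w (L k) ω = T ∧ D ≤ ‖deriv (fun w' ↦ bwdFlow (sleDriving κ ω) w' T) w‖}
    with hEdef
  set B₀ := rsFhatSlope b (w.re * y⁻¹) with hB₀
  have hB₀nn : 0 ≤ B₀ := (rsFhatSlope_pos _ _).le
  have hB₀eq : B₀ = (1 + w.re ^ 2 / y ^ 2) ^ b := by
    rw [hB₀, rsFhatSlope_apply, mul_pow, inv_pow, ← div_eq_mul_inv]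
  -- covering
  have hcover : {ω | δ / y ≤ ‖deriv (fun w' ↦ bwdFlow (sleDriving κ ω) w' t) w‖} ⊆
      ⋃ k ∈ levelSet y δ, E k := by
    intro ω hω
    obtain ⟨k, hk, h⟩ := exists_mem_levelSet_of_le_norm_deriv hw0 hw1 ht hω (κ := κ)
    exact Set.mem_biUnion hk h
  -- Chebyshev at each level
  have hEk : ∀ k, preWienerMeasure (E k) ≤
      ENNReal.ofReal (B₀ * (Real.exp a * (y / δ) ^ lam * (y * Real.exp k / δ) ^ (a - lam))) := by
    intro k
    have h := measure_bwdSLEImHit_le_and_le_norm_deriv_le (κ := κ) hb0 ha hw0 (hLge k) t hD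
    rw [← hy, ← hadef, ← hlamdef, ← hB₀, hLdef, hDdef, mul_assoc, level_bound_eq hw0 hδ0 k] at h
    exact h
  have hterm_nn : ∀ k, 0 ≤ B₀ * (Real.exp a * (y / δ) ^ lam * (y * Real.exp k / δ) ^ (a - lam)) :=
    fun k ↦ mul_nonneg hB₀nn (mul_nonneg (mul_nonneg (Real.exp_pos _).le
      (Real.rpow_nonneg (by positivity) _)) (Real.rpow_nonneg (by positivity) _))
  calc preWienerMeasure {ω | δ / y ≤ ‖deriv (fun w' ↦ bwdFlow (sleDriving κ ω) w' t) w‖}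
      ≤ preWienerMeasure (⋃ k ∈ levelSet y δ, E k) := measure_mono hcover
    _ ≤ ∑ k ∈ levelSet y δ, preWienerMeasure (E k) := measure_biUnion_finset_le _ _
    _ ≤ ∑ k ∈ levelSet y δ, ENNReal.ofReal
          (B₀ * (Real.exp a * (y / δ) ^ lam * (y * Real.exp k / δ) ^ (a - lam))) :=
        Finset.sum_le_sum fun k _ ↦ hEk k
    _ = ENNReal.ofReal (∑ k ∈ levelSet y δ,
          B₀ * (Real.exp a * (y / δ) ^ lam * (y * Real.exp k / δ) ^ (a - lam))) :=
        (ENNReal.ofReal_sum_of_nonneg (s := levelSet y δ) fun k _ ↦ hterm_nn k).symm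
    _ = ENNReal.ofReal (B₀ * Real.exp a * (y / δ) ^ lam *
          ∑ k ∈ levelSet y δ, (y * Real.exp k / δ) ^ (a - lam)) := by
        congr 1
        rw [Finset.mul_sum]
        exact Finset.sum_congr rfl fun k _ ↦ by ring
    _ ≤ ENNReal.ofReal (B₀ * Real.exp a * (y / δ) ^ lam * (levelSumConst (a - lam) * theta δ (a - lam))) := by
        refine ENNReal.ofReal_le_ofReal (mul_le_mul_of_nonneg_left (sum_levelSet_rpow_le hw0 hw1 hδ0 hδ1 _) ?_)
        exact mul_nonneg (mul_nonneg hB₀nn (Real.exp_pos _).le) (Real.rpow_nonneg (by positivity) _)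
    _ = ENNReal.ofReal (cor35Const κ b * (1 + w.re ^ 2 / y ^ 2) ^ b * (y / δ) ^ lam * theta δ (a - lam)) := by
        rw [cor35Const, ← hadef, ← hlamdef, hB₀eq]
        ring_nf

end Canonical


end Literature.Probability.RandomPlanarGeometry
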